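import Literature.AnabelianGeometry.EtaleTheta.ThetaKummerTranslates
import HarnessLib

/-!
# [EtTh] Prop. 1.4 (ii) along ALL powers of the deck generator from the identities AT the generator
# (function level; discharges the `hpow` binder of abc-iut-w5-d125's (P14iii-cl) non-torsion theorem) — proof-only

S. Mochizuki, *The étale theta function and its Frobenioid-theoretic manifestations*, Publ. RIMS **45**
(2009) [EtTh], §1, Prop. 1.4 (ii), PRIMS PDF p. 22 (printed 248):
"`Θ̈(q_X^{a/2} Ü) = (−1)^a · q_X^{−a²/2} · Ü^{−2a} · Θ̈(Ü)` for `a ∈ ℤ`" [cite: MochizukiEtTh2009, Prop 1.4 (ii) p.22].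
Layer L2 of the abc-iut cell, seat abc-iut-L2-t12 (gen 7); sequel of `Discharge/Sec1Prop15iiiOfThetaKummerInput.lean`
(p458029), whose function-level inputs are the identities AT THE DECK GENERATOR `σ₀` («`a = 1`»):
`σ₀ • Ü = const(a)·Ü` and `σ₀ • Θ̈ = const(b)·Ü^{−2}·Θ̈`. abc-iut-w5-d125's `ThetaKummerTranslates.lean`
(`not_isOfFinOrder_comap_conj_zpow_kummerTheta`, `EtaleThetaData.not_isOfFinOrder_comap_translate_of_kummer` — the
binder `h14`/`hfree` of the [IUTchII] Prop. 2.2 (ii) transport) takes the identity along ALL powers: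
`hpow : ∀ k : ℤ, ∃ c, σ₀ᵏ • Θ̈ = const(c)·Ü^{e k}·Θ̈`. PROOF-ONLY (no `def`): HERE `hpow` (with `e = −2`) is a THEOREM
of the two generator identities plus the GALOIS-STABILITY of the constants in the function module
(`hconst : ∀ σ c, ∃ c′, σ • const(c) = const(c′)` — `Π^tp_X` acts on `K̈ ⊆ Fn` through `Gal(K̈/K)`, p. 17
«`K̈ = K(ζ₂, q_X^{1/2})`», a Galois extension), by induction over `ℤ` (closure of the two identity shapes under
products and inverses in the `Π^tp_X`-module `Fn`). So ONE function-level package — the a = 1 identities — serves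
both the `Z`-display of Prop. 1.5 (iii) (p458029) and the non-torsion of the `ℤ`-translates (P14iii-cl).

* `ThetaKummerInput.coordLaw_mul` / `coordLaw_inv` / `thetaLaw_mul` / `thetaLaw_inv` — closure properties;
* **`ThetaKummerInput.translate_zpow_of_generator`** — `∀ k : ℤ, ∃ c, σ₀ᵏ • Θ̈ = const(c)·Ü^{(−2)·k}·Θ̈`
  (and `coord_zpow_of_generator` — `σ₀ᵏ • Ü = const·Ü`);
* **`EtaleThetaData.not_isOfFinOrder_comap_translate_of_generator`** — abc-iut-w5-d125's consumer shape with
  `hpow` DISCHARGED (`e := −2`).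
Classical; nothing of [EtTh] asserted beyond Prop. 1.4 (undisputed); no side taken on [IUTchIII] Cor. 3.12.
-/

noncomputable section

namespace Literature.AnabelianGeometry.EtaleTheta

namespace ThetaSetting

variable {p : ℕ} [Fact p.Prime] {D : ThetaSetting p}

namespace ThetaKummerInput

variable (T : D.ThetaKummerInput)
  (hconst : ∀ (σ : D.PiTemp) (c : (↥D.Kdd)ˣ), ∃ c' : (↥D.Kdd)ˣ, σ • T.const c = T.const c')

/-! ### Closure of the two identity shapes under products and inverses -/

include hconst in
/-- Coordinate law is multiplicative in `σ`: `τ₁ • Ü = const·Ü`, `τ₂ • Ü = const·Ü` ⇒ `(τ₁τ₂) • Ü = const·Ü`.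
[cite: MochizukiEtTh2009, Prop 1.4 (ii) p.22] -/
theorem coordLaw_mul {udd : T.Fn} {τ₁ τ₂ : D.PiTemp}
    (h₁ : ∃ a : (↥D.Kdd)ˣ, τ₁ • udd = T.const a * udd) (h₂ : ∃ a : (↥D.Kdd)ˣ, τ₂ • udd = T.const a * udd) :
    ∃ a : (↥D.Kdd)ˣ, (τ₁ * τ₂) • udd = T.const a * udd := by
  obtain ⟨a₁, h₁⟩ := h₁
  obtain ⟨a₂, h₂⟩ := h₂
  obtain ⟨a₂', ha₂'⟩ := hconst τ₁ a₂
  refine ⟨a₂' * a₁, ?_⟩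
  rw [mul_smul, h₂, smul_mul', ha₂', h₁, map_mul, mul_assoc]

include hconst in
/-- Coordinate law passes to the inverse: `τ • Ü = const·Ü` ⇒ `τ⁻¹ • Ü = const·Ü`.
[cite: MochizukiEtTh2009, Prop 1.4 (ii) p.22] -/
theorem coordLaw_inv {udd : T.Fn} {τ : D.PiTemp} (h : ∃ a : (↥D.Kdd)ˣ, τ • udd = T.const a * udd) :
    ∃ a : (↥D.Kdd)ˣ, τ⁻¹ • udd = T.const a * udd := by
  obtain ⟨a, h⟩ := h
  obtain ⟨a', ha'⟩ := hconst τ⁻¹ a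
  refine ⟨a'⁻¹, ?_⟩
  have e : udd = T.const a' * τ⁻¹ • udd := by
    conv_lhs => rw [← inv_smul_smul τ udd, h, smul_mul', ha']
  rw [map_inv, eq_inv_mul_iff_mul_eq, ← e]

include hconst in
/-- Theta law composes: `τ₁ • Θ̈ = const·Ü^{e₁}·Θ̈`, `τ₂ • Θ̈ = const·Ü^{e₂}·Θ̈`, `τ₁ • Ü = const·Ü` ⇒
`(τ₁τ₂) • Θ̈ = const·Ü^{e₁+e₂}·Θ̈`. [cite: MochizukiEtTh2009, Prop 1.4 (ii) p.22] -/
theorem thetaLaw_mul {udd : T.Fn} {τ₁ τ₂ : D.PiTemp} {e₁ e₂ : ℤ}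
    (hU₁ : ∃ a : (↥D.Kdd)ˣ, τ₁ • udd = T.const a * udd)
    (h₁ : ∃ c : (↥D.Kdd)ˣ, τ₁ • T.theta = T.const c * udd ^ e₁ * T.theta)
    (h₂ : ∃ c : (↥D.Kdd)ˣ, τ₂ • T.theta = T.const c * udd ^ e₂ * T.theta) :
    ∃ c : (↥D.Kdd)ˣ, (τ₁ * τ₂) • T.theta = T.const c * udd ^ (e₁ + e₂) * T.theta := by
  obtain ⟨a, ha⟩ := hU₁
  obtain ⟨c₁, h₁⟩ := h₁
  obtain ⟨c₂, h₂⟩ := h₂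
  obtain ⟨c₂', hc₂'⟩ := hconst τ₁ c₂
  refine ⟨c₂' * a ^ e₂ * c₁, ?_⟩
  rw [mul_smul, h₂, smul_mul', smul_mul', hc₂', smul_zpow', ha, h₁, mul_zpow, map_mul, map_mul, map_zpow,
    zpow_add]
  simp only [mul_assoc, mul_comm, mul_left_comm]

include hconst in
/-- Theta law passes to the inverse: `τ • Θ̈ = const·Ü^{e}·Θ̈`, `τ • Ü = const·Ü` ⇒ `τ⁻¹ • Θ̈ = const·Ü^{−e}·Θ̈`.
[cite: MochizukiEtTh2009, Prop 1.4 (ii) p.22] -/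
theorem thetaLaw_inv {udd : T.Fn} {τ : D.PiTemp} {e : ℤ}
    (hU : ∃ a : (↥D.Kdd)ˣ, τ • udd = T.const a * udd)
    (h : ∃ c : (↥D.Kdd)ˣ, τ • T.theta = T.const c * udd ^ e * T.theta) :
    ∃ c : (↥D.Kdd)ˣ, τ⁻¹ • T.theta = T.const c * udd ^ (-e) * T.theta := by
  obtain ⟨a', ha'⟩ := T.coordLaw_inv hconst hU
  obtain ⟨c, h⟩ := h
  obtain ⟨c', hc'⟩ := hconst τ⁻¹ c
  refine ⟨(c' * a' ^ e)⁻¹, ?_⟩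
  have h0 : τ⁻¹ • (τ • T.theta) = T.theta := inv_smul_smul τ T.theta
  rw [h, smul_mul', smul_mul', hc', smul_zpow', ha', mul_zpow, ← map_zpow, ← mul_assoc (T.const c'),
    ← map_mul] at h0
  rw [map_inv, zpow_neg, ← mul_inv]
  exact eq_inv_mul_of_mul_eq h0

/-! ### All powers of the generator -/

include hconst in
/-- **The coordinate law along all powers**: `σ₀ᵏ • Ü = const·Ü` for every `k : ℤ`.
[cite: MochizukiEtTh2009, Prop 1.4 (ii) p.22] -/
theorem coord_zpow_of_generator {udd : T.Fn} {σ₀ : D.PiTemp}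
    (hU : ∃ a : (↥D.Kdd)ˣ, σ₀ • udd = T.const a * udd) (k : ℤ) :
    ∃ a : (↥D.Kdd)ˣ, (σ₀ ^ k) • udd = T.const a * udd := by
  induction k using Int.induction_on with
  | zero => exact ⟨1, by rw [zpow_zero, one_smul, map_one, one_mul]⟩
  | succ k ih => rw [zpow_add_one]; exact T.coordLaw_mul hconst ih hU
  | pred k ih => rw [zpow_sub_one]; exact T.coordLaw_mul hconst ih (T.coordLaw_inv hconst hU)

include hconst in
/-- **Prop. 1.4 (ii) along ALL powers of the deck generator from the identities at the generator**:
`σ₀ᵏ • Θ̈ = const(c_k)·Ü^{−2k}·Θ̈` for every `k : ℤ` — abc-iut-w5-d125's binder `hpow` (`e = −2`).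
[cite: MochizukiEtTh2009, Prop 1.4 (ii) p.22] -/
theorem translate_zpow_of_generator {udd : T.Fn} {σ₀ : D.PiTemp}
    (hU : ∃ a : (↥D.Kdd)ˣ, σ₀ • udd = T.const a * udd)
    (hΘ : ∃ c : (↥D.Kdd)ˣ, σ₀ • T.theta = T.const c * udd ^ (-(2 : ℤ)) * T.theta) (k : ℤ) :
    ∃ c : (↥D.Kdd)ˣ, (σ₀ ^ k) • T.theta = T.const c * udd ^ (-2 * k) * T.theta := by
  induction k using Int.induction_on with
  | zero => exact ⟨1, by rw [zpow_zero, one_smul, map_one, one_mul, mul_zero, zpow_zero, one_mul]⟩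
  | succ k ih =>
    rw [zpow_add_one, show -2 * ((k : ℤ) + 1) = -2 * (k : ℤ) + -(2 : ℤ) by ring]
    exact T.thetaLaw_mul hconst (T.coord_zpow_of_generator hconst hU k) ih hΘ
  | pred k ih =>
    rw [zpow_sub_one, show -2 * (-(k : ℤ) - 1) = -2 * -(k : ℤ) + -(-(2 : ℤ)) by ring]
    exact T.thetaLaw_mul hconst (T.coord_zpow_of_generator hconst hU (-(k : ℤ))) ih
      (T.thetaLaw_inv hconst hU hΘ)

end ThetaKummerInput

/-! ### The consumer shape with `hpow` discharged -/

namespace EtaleThetaData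

variable (T : D.ThetaKummerInput)

/-- **(P14iii-cl) for the étale theta class from the identities AT THE GENERATOR** — abc-iut-w5-d125's
`not_isOfFinOrder_comap_translate_of_kummer` with its binder `hpow` a THEOREM of the two generator identities and
the Galois-stability of constants (`e := −2`). [cite: MochizukiEtTh2009, Prop 1.4 (ii) p.22] -/
theorem not_isOfFinOrder_comap_translate_of_generator (E : D.EtaleThetaData) [D.GtpYdd.Normal]
    (hη : E.etaDd = T.kummerTheta) {udd : T.Fn} (hu : udd ∈ MulAction.fixedPoints D.GtpYdd T.Fn)
    (xpow : ∀ m : ℤ, RootSystem (udd ^ m)) (σ₀ : D.PiTemp)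
    (hconst : ∀ (σ : D.PiTemp) (c : (↥D.Kdd)ˣ), ∃ c' : (↥D.Kdd)ˣ, σ • T.const c = T.const c')
    (hU : ∃ a : (↥D.Kdd)ˣ, σ₀ • udd = T.const a * udd)
    (hΘ : ∃ c : (↥D.Kdd)ˣ, σ₀ • T.theta = T.const c * udd ^ (-(2 : ℤ)) * T.theta)
    (hcoeff : Function.Bijective T.coeff.hom)
    {K : Subgroup D.PiTemp} {H₀ : Subgroup K} (hle : H₀.map K.subtype ≤ D.GtpYdd)
    (ord : T.Fn →* Multiplicative ℚ) (hordc : ∀ c, ord (T.const c) = 1) (hordu : ord udd ≠ 1)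
    {d : ℕ} (hd : 0 < d)
    (hint : ∀ f ∈ MulAction.fixedPoints (H₀.map K.subtype) T.Fn, ∃ z : ℤ, Multiplicative.toAdd (ord f) = z / d) :
    ∀ k : ℤ, k ≠ 0 → ¬ IsOfFinOrder (ContH1.comap D.toTheta D.DeltaTheta K.subtype continuous_subtype_val hle
      (ContH1.conj D.toTheta D.DeltaTheta (σ₀ ^ k) E.etaDd * E.etaDd⁻¹)) :=
  E.not_isOfFinOrder_comap_translate_of_kummer T hη hu xpow σ₀ (-2) (by norm_num)
    (T.translate_zpow_of_generator hconst hU hΘ) hcoeff hle ord hordc hordu hd hint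

end EtaleThetaData

end ThetaSetting

end Literature.AnabelianGeometry.EtaleTheta

end
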